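import Summits.CriticalPhenomena.SAWScalingLimit.Theorems.SAWLeftRightFKGLeftRightFKGTP2Defs
import Summits.CriticalPhenomena.SAWScalingLimit.Theorems.SAWTotalPositivityBoundaryTP2Kernel
import HarnessLib

/-!
# Stub `stub_cornerAssembly` of line `corner-localisation` (lead c1 reshape v5), helper file 3: through the dictionary

Crux `LeftRightFKG` (stmt-CriticalPhenomena-11232). Consequences of the class dictionary `ClassDictionaryAt Ω δ a b`
(registered stub `stub_classDictionary`; here a HYPOTHESIS `hD`): chords of a class with end-steps `(u, w)` ≃
self-avoiding paths `u → w` of the free graph `freeGraph Ω δ k π m σ`.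

* `sum_dirSet_eq`: the `(u, w)` entry of the end-step matrix at fugacity `x` is `x^{k+m+2}` times the path kernel
  `BoundaryTP2.pathKernel (freeGraph …) x u w` (real form);
* `interlaced_of_freeMeet`: if every chord of direction class `(u, w')` meets every chord of `(u', w)` in their free
  middles, the quadruple `(u, w, w', u')` is `BoundaryTP2.Interlaced` in the free graph;
* `allMeet_of_freeMeet`, `allMeet_of_freeMeetR`: if every `u`-chord meets every `u'`-chord (resp. every chord
  entering through `w` meets every chord entering through `w'`), then all free-graph paths from `u` and from `u'`
  to the free neighbours of `σ m` (resp. from `w`, `w'` to the free neighbours of `π k`) meet pairwise — the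
  hypothesis of `AllMeetProportionalAt`.
-/

noncomputable section

open Finset SimpleGraph
open Literature.Probability.LatticeModels Literature.Probability.RandomPlanarGeometry
open scoped Classical ENNReal

namespace Summit.CriticalPhenomena.SAWScalingLimit.Theorems.LeftRightFKG.CornerLoc

namespace CornerAssembly

variable {Ω : Set ℂ} {δ : ℝ} {a b : Site 2} {k : ℕ} {π : ℕ → Site 2} {m : ℕ} {σ : ℕ → Site 2}

/-- A common free vertex of two chords is a common vertex of their dictionary paths. [folklore] -/
theorem exists_mem_support_of_freeMeet {u₁ w₁ u₂ w₂ : Site 2}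
    (e₁ : {γ : SAW.DomainSAW Ω δ a b // γ ∈ dirSet k π m σ u₁ w₁} ≃ (freeGraph Ω δ k π m σ).Path u₁ w₁)
    (h₁ : ∀ γ, ∀ v : Site 2, v ∈ (e₁ γ).1.support ↔
      ∃ i : ℕ, k < i ∧ i + m < γ.1.length ∧ γ.1.walk.getVert i = v)
    (e₂ : {γ : SAW.DomainSAW Ω δ a b // γ ∈ dirSet k π m σ u₂ w₂} ≃ (freeGraph Ω δ k π m σ).Path u₂ w₂)
    (h₂ : ∀ γ, ∀ v : Site 2, v ∈ (e₂ γ).1.support ↔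
      ∃ i : ℕ, k < i ∧ i + m < γ.1.length ∧ γ.1.walk.getVert i = v)
    (γ₁ : {γ : SAW.DomainSAW Ω δ a b // γ ∈ dirSet k π m σ u₁ w₁})
    (γ₂ : {γ : SAW.DomainSAW Ω δ a b // γ ∈ dirSet k π m σ u₂ w₂}) (hfm : FreeMeet k m γ₁.1 γ₂.1) :
    ∃ v, v ∈ (e₁ γ₁).1.support ∧ v ∈ (e₂ γ₂).1.support := by
  obtain ⟨i, j, hi, him, hj, hjm, hij⟩ := hfm
  exact ⟨γ₁.1.walk.getVert i, (h₁ γ₁ _).2 ⟨i, hi, him, rfl⟩, (h₂ γ₂ _).2 ⟨j, hj, hjm, hij.symm⟩⟩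

/-- THE MATRIX ENTRY IS A PATH KERNEL: with two distinct chords in the class, for free `u ∼ π k` and free
`w ∼ σ m` the fugacity-`x` weight of the direction class `(u, w)` is `x^{k+m+2} · Z_H(u,w)`, `H` the free graph
(real form, `x ≥ 0`). [folklore] -/
theorem sum_dirSet_eq [Fintype (SAW.DomainSAW Ω δ a b)] (hD : ClassDictionaryAt Ω δ a b)
    (h2 : ∃ γ₁ γ₂ : SAW.DomainSAW Ω δ a b, γ₁ ∈ cls k π m σ ∧ γ₂ ∈ cls k π m σ ∧ γ₁ ≠ γ₂)
    (hfin : (freeGraph Ω δ k π m σ).support.Finite) {x : ℝ} (hx : 0 ≤ x) {u w : Site 2}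
    (hu : u ∉ fixedSet k π m σ) (hw : w ∉ fixedSet k π m σ) (hpu : (discreteDomainGraph Ω δ).Adj (π k) u)
    (hwq : (discreteDomainGraph Ω δ).Adj w (σ m)) :
    ∑ γ ∈ univ.filter (· ∈ (dirSet k π m σ u w : Set (SAW.DomainSAW Ω δ a b))), x ^ γ.length =
      x ^ (k + m + 2) * (BoundaryTP2.pathKernel (freeGraph Ω δ k π m σ) x u w).toReal := by
  obtain ⟨e, hlen, -⟩ := hD k π m σ h2 u w hu hw hpu hwq
  haveI : Finite ((freeGraph Ω δ k π m σ).Path u w) := BoundaryTP2.finite_path hfin u w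
  haveI : Fintype ((freeGraph Ω δ k π m σ).Path u w) := Fintype.ofFinite _
  rw [BoundaryTP2.pathKernel_eq_sum, ENNReal.toReal_sum (fun _ _ => ENNReal.ofReal_ne_top), mul_sum]
  rw [sum_subtype (univ.filter (· ∈ (dirSet k π m σ u w : Set (SAW.DomainSAW Ω δ a b))))
    (p := (· ∈ (dirSet k π m σ u w : Set (SAW.DomainSAW Ω δ a b)))) (by simp)]
  refine Fintype.sum_equiv e _ _ fun γ => ?_
  rw [ENNReal.toReal_ofReal (pow_nonneg hx _), ← pow_add, add_comm, hlen γ]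

/-- INTERLACING FROM MEETING CHORDS: if every chord of direction class `(u, w')` meets every chord of class
`(u', w)` in their free middles, then every self-avoiding path `u → w'` of the free graph meets every path
`w → u'` — the quadruple `(u, w, w', u')` is interlaced. [folklore] -/
theorem interlaced_of_freeMeet (hD : ClassDictionaryAt Ω δ a b)
    (h2 : ∃ γ₁ γ₂ : SAW.DomainSAW Ω δ a b, γ₁ ∈ cls k π m σ ∧ γ₂ ∈ cls k π m σ ∧ γ₁ ≠ γ₂)
    {u u' w w' : Site 2} (hu : u ∉ fixedSet k π m σ) (hu' : u' ∉ fixedSet k π m σ)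
    (hw : w ∉ fixedSet k π m σ) (hw' : w' ∉ fixedSet k π m σ)
    (hpu : (discreteDomainGraph Ω δ).Adj (π k) u) (hpu' : (discreteDomainGraph Ω δ).Adj (π k) u')
    (hwq : (discreteDomainGraph Ω δ).Adj w (σ m)) (hw'q : (discreteDomainGraph Ω δ).Adj w' (σ m))
    (hmeet : ∀ γ₁ ∈ (dirSet k π m σ u w' : Set (SAW.DomainSAW Ω δ a b)), ∀ γ₂ ∈ dirSet k π m σ u' w,
      FreeMeet k m γ₁ γ₂) :
    BoundaryTP2.Interlaced (freeGraph Ω δ k π m σ) u w w' u' := by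
  obtain ⟨e₁, -, hs₁⟩ := hD k π m σ h2 u w' hu hw' hpu hw'q
  obtain ⟨e₂, -, hs₂⟩ := hD k π m σ h2 u' w hu' hw hpu' hwq
  intro P Q
  obtain ⟨v, hv₁, hv₂⟩ := exists_mem_support_of_freeMeet e₁ hs₁ e₂ hs₂ (e₁.symm P) (e₂.symm Q.reverse)
    (hmeet _ (e₁.symm P).2 _ (e₂.symm Q.reverse).2)
  rw [Equiv.apply_symm_apply] at hv₁ hv₂
  refine ⟨v, hv₁, ?_⟩
  rw [Path.reverse_coe, Walk.support_reverse, List.mem_reverse] at hv₂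
  exact hv₂

/-- ALL-MEET AT THE NEAR END: if every chord with next step `u` meets every chord with next step `u'` in their free
middles, then all free-graph paths from `u` and from `u'` to free neighbours of `σ m` meet pairwise. [folklore] -/
theorem allMeet_of_freeMeet (hD : ClassDictionaryAt Ω δ a b)
    (h2 : ∃ γ₁ γ₂ : SAW.DomainSAW Ω δ a b, γ₁ ∈ cls k π m σ ∧ γ₂ ∈ cls k π m σ ∧ γ₁ ≠ γ₂)
    {u u' : Site 2} (hu : u ∉ fixedSet k π m σ) (hu' : u' ∉ fixedSet k π m σ)
    (hpu : (discreteDomainGraph Ω δ).Adj (π k) u) (hpu' : (discreteDomainGraph Ω δ).Adj (π k) u')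
    (hmeet : ∀ w w' : Site 2, ∀ γ₁ ∈ (dirSet k π m σ u w : Set (SAW.DomainSAW Ω δ a b)),
      ∀ γ₂ ∈ dirSet k π m σ u' w', FreeMeet k m γ₁ γ₂) :
    ∀ (w w' : Site 2) (P : (freeGraph Ω δ k π m σ).Path u w) (Q : (freeGraph Ω δ k π m σ).Path u' w'),
      w ∈ {v | v ∉ fixedSet k π m σ ∧ (discreteDomainGraph Ω δ).Adj v (σ m)} →
      w' ∈ {v | v ∉ fixedSet k π m σ ∧ (discreteDomainGraph Ω δ).Adj v (σ m)} →
      ∃ v, v ∈ P.1.support ∧ v ∈ Q.1.support := by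
  intro w w' P Q hw hw'
  obtain ⟨e₁, -, hs₁⟩ := hD k π m σ h2 u w hu hw.1 hpu hw.2
  obtain ⟨e₂, -, hs₂⟩ := hD k π m σ h2 u' w' hu' hw'.1 hpu' hw'.2
  obtain ⟨v, hv₁, hv₂⟩ := exists_mem_support_of_freeMeet e₁ hs₁ e₂ hs₂ (e₁.symm P) (e₂.symm Q)
    (hmeet w w' _ (e₁.symm P).2 _ (e₂.symm Q).2)
  rw [Equiv.apply_symm_apply] at hv₁ hv₂
  exact ⟨v, hv₁, hv₂⟩

/-- ALL-MEET AT THE FAR END (mirror): if every chord with previous step `w` meets every chord with previous step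
`w'`, then all free-graph paths from `w` and from `w'` to free neighbours of `π k` meet pairwise. [folklore] -/
theorem allMeet_of_freeMeetR (hD : ClassDictionaryAt Ω δ a b)
    (h2 : ∃ γ₁ γ₂ : SAW.DomainSAW Ω δ a b, γ₁ ∈ cls k π m σ ∧ γ₂ ∈ cls k π m σ ∧ γ₁ ≠ γ₂)
    {w w' : Site 2} (hw : w ∉ fixedSet k π m σ) (hw' : w' ∉ fixedSet k π m σ)
    (hwq : (discreteDomainGraph Ω δ).Adj w (σ m)) (hw'q : (discreteDomainGraph Ω δ).Adj w' (σ m))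
    (hmeet : ∀ u u' : Site 2, ∀ γ₁ ∈ (dirSet k π m σ u w : Set (SAW.DomainSAW Ω δ a b)),
      ∀ γ₂ ∈ dirSet k π m σ u' w', FreeMeet k m γ₁ γ₂) :
    ∀ (t t' : Site 2) (P : (freeGraph Ω δ k π m σ).Path w t) (Q : (freeGraph Ω δ k π m σ).Path w' t'),
      t ∈ {v | v ∉ fixedSet k π m σ ∧ (discreteDomainGraph Ω δ).Adj (π k) v} →
      t' ∈ {v | v ∉ fixedSet k π m σ ∧ (discreteDomainGraph Ω δ).Adj (π k) v} →
      ∃ v, v ∈ P.1.support ∧ v ∈ Q.1.support := by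
  intro t t' P Q ht ht'
  obtain ⟨e₁, -, hs₁⟩ := hD k π m σ h2 t w ht.1 hw ht.2 hwq
  obtain ⟨e₂, -, hs₂⟩ := hD k π m σ h2 t' w' ht'.1 hw' ht'.2 hw'q
  obtain ⟨v, hv₁, hv₂⟩ := exists_mem_support_of_freeMeet e₁ hs₁ e₂ hs₂ (e₁.symm P.reverse)
    (e₂.symm Q.reverse) (hmeet t t' _ (e₁.symm P.reverse).2 _ (e₂.symm Q.reverse).2)
  rw [Equiv.apply_symm_apply, Path.reverse_coe, Walk.support_reverse, List.mem_reverse] at hv₁ hv₂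
  exact ⟨v, hv₁, hv₂⟩

end CornerAssembly

/-- REGISTERED SUB-GOAL `stub_cornerAssemblyAux3` of stub `stub_cornerAssembly` (this helper file's pivot, recorded on
the crux item so that the file lands as a `--supports` proof): interlacing of a corner quadruple of the free graph
from meeting chords, through the class dictionary (`CornerAssembly.interlaced_of_freeMeet`). [folklore] -/
theorem stub_cornerAssemblyAux3 : ∀ (Ω : Set ℂ) (δ : ℝ) (a b : Site 2) (k : ℕ) (π : ℕ → Site 2) (m : ℕ)
    (σ : ℕ → Site 2), ClassDictionaryAt Ω δ a b →
    (∃ γ₁ γ₂ : SAW.DomainSAW Ω δ a b, γ₁ ∈ cls k π m σ ∧ γ₂ ∈ cls k π m σ ∧ γ₁ ≠ γ₂) →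
    ∀ u u' w w' : Site 2, u ∉ fixedSet k π m σ → u' ∉ fixedSet k π m σ → w ∉ fixedSet k π m σ →
    w' ∉ fixedSet k π m σ → (discreteDomainGraph Ω δ).Adj (π k) u → (discreteDomainGraph Ω δ).Adj (π k) u' →
    (discreteDomainGraph Ω δ).Adj w (σ m) → (discreteDomainGraph Ω δ).Adj w' (σ m) →
    (∀ γ₁ ∈ (dirSet k π m σ u w' : Set (SAW.DomainSAW Ω δ a b)), ∀ γ₂ ∈ dirSet k π m σ u' w,
      FreeMeet k m γ₁ γ₂) →
    BoundaryTP2.Interlaced (freeGraph Ω δ k π m σ) u w w' u' :=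
  fun _ _ _ _ _ _ _ _ hD h2 _ _ _ _ hu hu' hw hw' hpu hpu' hwq hw'q hmeet =>
    CornerAssembly.interlaced_of_freeMeet hD h2 hu hu' hw hw' hpu hpu' hwq hw'q hmeet

end Summit.CriticalPhenomena.SAWScalingLimit.Theorems.LeftRightFKG.CornerLoc

end
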